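import Summits.CriticalPhenomena.PercolationContinuityZ3.Theorems.SahiCMTP2Basic
import Summits.CriticalPhenomena.PercolationContinuityZ3.Theorems.SahiCISCylinderLEConverse
import Summits.CriticalPhenomena.PercolationContinuityZ3.Theorems.SahiBoxTP2Affiliation

/-!
# Density-free cMTP₂ (Fuchs–Wang 2026, (5.1)) implies CIS — with no density and no continuity

Support file of the Sahi cell (`prim-sahi`, typer seat, generation 18; `--supports stmt-CriticalPhenomena-4575`).
One definition (`IsCMTP2cis`, the recursive "(5.1) for every split `([i−1], {i})`"), theorems otherwise; no named facts,
no sorries.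

Fuchs–Wang prove `cMTP₂(X_B|X_A) ⇒ SI(X_B|X_A)` (Thm. 2.8 (1)) for their DENSITY notion (1.2), dividing by the density
`f_{X_A}`; and `CIS(X)` is `SI(X_i | X_1,…,X_{i−1})` for all `i` (Remark 2.9).  For the density-free notion (5.1)
nothing is in print.  Here, for laws on the unit cube `Q_d` (the Sahi cell's CIS setting):

* `cylinder_mul_le_of_isCMTP2Set` (any product of measurable lattices with a cofinal sequence / a top in the second
  block) — **(5.1) ⟹ stochastic monotonicity in cylinder form**: for measurable `C ≤ D` (pointwise) of the first block
  and every `t`, `μ(C × Y) μ(D × (−∞,t]) ≤ μ(C × (−∞,t]) μ(D × Y)`, i.e. `P(X_B ≤ t | X_A ∈ D) ≤ P(X_B ≤ t | X_A ∈ C)`.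
* **`condIncrLastLE_of_isCMTP2Set`** — on `Q_{d+1}`: (5.1) for the split (first `d` coordinates | last coordinate)
  implies the corrected Colangelo–Müller–Scarsini Definition 4 for the last coordinate (`CondIncrLastLE`, weak pointwise
  comparability of the conditioning sets, all measurable upper `V`), via the cdf-to-upper-set transfer
  `measure_upperSet_le_of_Iic_le` applied to the two conditional laws of the last coordinate.
* `IsCMTP2cis d μ` — (5.1) for every split `([i−1], {i})`, `i ≤ d` (the cMTP₂ analogue of CIS, recursively on the last
  coordinate exactly like `IsCIScylLE` / `IsCISae`); **`IsCMTP2cis.isCIScylLE`**, **`IsCMTP2cis.isCISae`** — it implies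
  CIS in the a.e.-kernel sense for EVERY probability law on `Q_d` (through generation 17's `isCISae_iff_isCIScylLE`),
  hence a monotone Borel coupling to Lebesgue measure, positive association, and Sahi positivity of order `n` given
  `L(d,n)` (`IsCMTP2cis.exists_monotone_coupling`, `.isPositivelyAssociated`, `.msahiE_nonneg`).
* `IsBoxTP2.isCMTP2cis` — box-TP₂ (density-free MTP₂) ⟹ `IsCMTP2cis` (so the chain
  MTP₂ ⟹ cMTP₂-CIS ⟹ CIS ⟹ PA of [FuchsWang2026] Fig. 2.2 / [MullerStoyan2002] Thm. 3.10.16 holds density-free on `Q_d`).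

No sorries, no new axioms.  References: [FuchsWang2026] Thm. 2.8 (1), Rem. 2.9, §5 (5.1); the density-free statements
are this work.
-/

noncomputable section

namespace Summit.CriticalPhenomena.PercolationContinuityZ3.Theorems.SahiCMTP2

open MeasureTheory ProbabilityTheory Set Filter Topology Function
open Literature.Probability.LatticeModels Literature.Probability.LatticeModels.Affiliation
open Summit.CriticalPhenomena.PercolationContinuityZ3.Theorems.SahiBoxTP2
open Summit.CriticalPhenomena.PercolationContinuityZ3.Theorems.SahiCIS
open scoped ENNReal SetFamily unitInterval

/-! ### (5.1) ⟹ stochastic monotonicity in cylinder form -/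

section Cylinder

variable {X Y : Type*} [MeasurableSpace X] [MeasurableSpace Y] [Lattice X] [Lattice Y]

/-- **(5.1) ⟹ stochastic monotonicity in cylinder form**: for measurable `C, D` with `c ≤ d` for all `c ∈ C`, `d ∈ D`
(so `C ∧ D ⊆ C`, `C ∨ D ⊆ D`) and every `t`, `μ(C × Y) μ(D × (−∞,t]) ≤ μ(C × (−∞,t]) μ(D × Y)` — the conditional law of
the second block given `X_A ∈ D` is stochastically larger, on lower orthants, than given `X_A ∈ C`.  The second block is
exhausted along a cofinal increasing sequence. [this work] -/
theorem cylinder_mul_le_of_isCMTP2Set {μ : Measure (X × Y)} (h : IsCMTP2Set μ) {C D : Set X}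
    (hC : MeasurableSet C) (hD : MeasurableSet D) (hCD : ∀ c ∈ C, ∀ d ∈ D, c ≤ d) {s : ℕ → Y} (hs : Monotone s)
    (hcof : ∀ y, ∃ n, y ≤ s n) (t : Y) :
    μ (C ×ˢ univ) * μ (D ×ˢ Iic t) ≤ μ (C ×ˢ Iic t) * μ (D ×ˢ univ) := by
  have h1 : C ⊼ D ⊆ C := Set.infs_subset_iff.2 fun c hc d hd => by
    rw [inf_eq_left.2 (hCD c hc d hd)]; exact hc
  have h2 : C ⊻ D ⊆ D := Set.sups_subset_iff.2 fun c hc d hd => by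
    rw [sup_eq_right.2 (hCD c hc d hd)]; exact hd
  have hU : C ×ˢ (univ : Set Y) = ⋃ n, C ×ˢ Iic (s n) := by
    rw [← Set.prod_iUnion]
    congr 1
    ext y
    simp only [mem_univ, mem_iUnion, mem_Iic, true_iff]
    exact hcof y
  have hmono : Monotone fun n => C ×ˢ Iic (s n) :=
    fun m n hmn => prod_mono Subset.rfl (Iic_subset_Iic.2 (hs hmn))
  rw [hU, hmono.measure_iUnion, ENNReal.iSup_mul]
  refine iSup_le fun n => (h hC hD (s n) t).trans ?_
  exact mul_le_mul' (measure_mono (prod_mono h1 (Iic_subset_Iic.2 inf_le_right)))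
    (measure_mono (prod_mono h2 (subset_univ _)))

/-- The same when the second block has a top element. [this work] -/
theorem cylinder_mul_le_of_isCMTP2Set_of_orderTop [OrderTop Y] {μ : Measure (X × Y)} (h : IsCMTP2Set μ)
    {C D : Set X} (hC : MeasurableSet C) (hD : MeasurableSet D) (hCD : ∀ c ∈ C, ∀ d ∈ D, c ≤ d) (t : Y) :
    μ (C ×ˢ univ) * μ (D ×ˢ Iic t) ≤ μ (C ×ˢ Iic t) * μ (D ×ˢ univ) :=
  cylinder_mul_le_of_isCMTP2Set h hC hD hCD (s := fun _ => ⊤) (fun _ _ _ => le_rfl) (fun _ => ⟨0, le_top⟩) t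

end Cylinder

/-! ### On the unit cube: (5.1) for (first `d` | last) ⟹ the corrected Definition 4 for the last coordinate -/

section Cube

variable {d : ℕ}

/-- Rewriting the marginal of the first `d` coordinates as a cylinder mass. [folklore] -/
theorem fst_apply_eq_prod_univ {X Y : Type*} [MeasurableSpace X] [MeasurableSpace Y] (ν : Measure (X × Y))
    {S : Set X} (hS : MeasurableSet S) : ν.fst S = ν (S ×ˢ (univ : Set Y)) := by
  rw [Measure.fst_apply hS]
  congr 1
  ext p
  simp only [mem_preimage, mem_prod, mem_univ, and_true]

/-- The normalised conditional law of the second coordinate given `{first ∈ A}`, evaluated. [folklore] -/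
theorem smul_map_snd_restrict_apply {X Y : Type*} [MeasurableSpace X] [MeasurableSpace Y] (ν : Measure (X × Y))
    (A : Set X) (c : ℝ≥0∞) {S : Set Y} (hS : MeasurableSet S) :
    (c • (ν.restrict (A ×ˢ univ)).map Prod.snd) S = c * ν (A ×ˢ S) := by
  rw [Measure.smul_apply, smul_eq_mul, Measure.map_apply measurable_snd hS,
    Measure.restrict_apply (measurable_snd hS)]
  congr 2
  ext p
  simp only [mem_inter_iff, mem_preimage, mem_prod, mem_univ, and_true]
  exact and_comm

/-- **(5.1) for the split (first `d` coordinates | last coordinate) ⟹ the corrected Definition 4 for the last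
coordinate** (`CondIncrLastLE`: `μ(x' ∈ A, x_d ∈ V) μ(x' ∈ B) ≤ μ(x' ∈ B, x_d ∈ V) μ(x' ∈ A)` for measurable `A ≤ B`
pointwise and measurable upper `V ⊆ [0,1]`), for every probability law on `Q_{d+1}` — density-free
[FuchsWang2026] Thm. 2.8 (1) for this split. [this work] -/
theorem condIncrLastLE_of_isCMTP2Set (μ : Measure (Fin (d + 1) → I)) [IsProbabilityMeasure μ]
    (h : IsCMTP2Set (μ.map initLast)) : CondIncrLastLE μ := by
  intro A B hAm hBm hAB V hV hVm
  set ν : Measure ((Fin d → I) × I) := μ.map initLast with hν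
  haveI : IsProbabilityMeasure ν := Measure.isProbabilityMeasure_map measurable_initLast.aemeasurable
  rw [fst_apply_eq_prod_univ ν hBm, fst_apply_eq_prod_univ ν hAm]
  have hIic : ∀ t : I, ν (A ×ˢ univ) * ν (B ×ˢ Iic t) ≤ ν (A ×ˢ Iic t) * ν (B ×ˢ univ) := fun t =>
    cylinder_mul_le_of_isCMTP2Set_of_orderTop h hAm hBm hAB t
  set mA := ν (A ×ˢ (univ : Set I)) with hmA
  set mB := ν (B ×ˢ (univ : Set I)) with hmB
  by_cases hA0 : mA = 0
  · have h0 : ν (A ×ˢ V) = 0 := measure_mono_null (prod_mono Subset.rfl (subset_univ _)) hA0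
    rw [h0, zero_mul]; exact bot_le
  by_cases hB0 : mB = 0
  · rw [hB0, mul_zero]; exact bot_le
  have hAtop : mA ≠ ∞ := measure_ne_top _ _
  have hBtop : mB ≠ ∞ := measure_ne_top _ _
  -- the two conditional laws of the last coordinate, as probability measures on `[0,1]`
  set P : Measure I := mA⁻¹ • (ν.restrict (A ×ˢ univ)).map Prod.snd with hP
  set Q : Measure I := mB⁻¹ • (ν.restrict (B ×ˢ univ)).map Prod.snd with hQ
  have hPapp : ∀ {S : Set I}, MeasurableSet S → P S = mA⁻¹ * ν (A ×ˢ S) := fun hS =>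
    smul_map_snd_restrict_apply ν A _ hS
  have hQapp : ∀ {S : Set I}, MeasurableSet S → Q S = mB⁻¹ * ν (B ×ˢ S) := fun hS =>
    smul_map_snd_restrict_apply ν B _ hS
  haveI : IsProbabilityMeasure P :=
    ⟨by rw [hPapp MeasurableSet.univ]; exact ENNReal.inv_mul_cancel hA0 hAtop⟩
  haveI : IsProbabilityMeasure Q :=
    ⟨by rw [hQapp MeasurableSet.univ]; exact ENNReal.inv_mul_cancel hB0 hBtop⟩
  have hQP : ∀ x : I, Q (Iic x) ≤ P (Iic x) := by
    intro x
    rw [hPapp measurableSet_Iic, hQapp measurableSet_Iic]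
    calc mB⁻¹ * ν (B ×ˢ Iic x) = mA⁻¹ * (mA * ν (B ×ˢ Iic x)) * mB⁻¹ := by
          rw [← mul_assoc, ENNReal.inv_mul_cancel hA0 hAtop, one_mul, mul_comm]
      _ ≤ mA⁻¹ * (ν (A ×ˢ Iic x) * mB) * mB⁻¹ := mul_le_mul' (mul_le_mul' le_rfl (hIic x)) le_rfl
      _ = mA⁻¹ * ν (A ×ˢ Iic x) := by
          rw [mul_assoc, mul_assoc, ENNReal.mul_inv_cancel hB0 hBtop, mul_one]
  have hPQV := measure_upperSet_le_of_Iic_le P Q hQP hV hVm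
  rw [hPapp hVm, hQapp hVm] at hPQV
  have e : mB⁻¹ * ν (B ×ˢ V) * mB = ν (B ×ˢ V) := by
    rw [mul_comm mB⁻¹, mul_assoc, ENNReal.inv_mul_cancel hB0 hBtop, mul_one]
  calc ν (A ×ˢ V) * mB = mA * (mA⁻¹ * ν (A ×ˢ V)) * mB := by
        rw [← mul_assoc, ENNReal.mul_inv_cancel hA0 hAtop, one_mul]
    _ ≤ mA * (mB⁻¹ * ν (B ×ˢ V)) * mB := mul_le_mul' (mul_le_mul' le_rfl hPQV) le_rfl
    _ = ν (B ×ˢ V) * mA := by rw [mul_assoc mA, e, mul_comm]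

/-! ### All splits `([i−1], {i})`: the cMTP₂ analogue of CIS, and CIS itself -/

/-- **Fuchs–Wang's cMTP₂-CIS, density-free**: a law `μ` on `Q_d` satisfies (5.1) for every split
`A = {0,…,i−1}`, `B = {i}` (`i < d`), phrased recursively on the last coordinate exactly like the cell's `IsCISae` /
`IsCIScylLE`: nothing in dimension `0`; in dimension `d+1`, the law of the first `d` coordinates is `IsCMTP2cis d` and
the law of `((x_0,…,x_{d−1}), x_d)` satisfies `IsCMTP2Set`.  (This is to (5.1) what `CIS(X)` of [FuchsWang2026]
Rem. 2.9 is to `SI`.) [this work] -/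
def IsCMTP2cis : (d : ℕ) → Measure (Fin d → I) → Prop
  | 0, _ => True
  | d + 1, μ => IsCMTP2cis d (μ.map initLast).fst ∧ IsCMTP2Set (μ.map initLast)

/-- Unfolding. [this work] -/
theorem isCMTP2cis_succ_iff (μ : Measure (Fin (d + 1) → I)) :
    IsCMTP2cis (d + 1) μ ↔ IsCMTP2cis d (μ.map initLast).fst ∧ IsCMTP2Set (μ.map initLast) := Iff.rfl

/-- **cMTP₂-CIS ⟹ the corrected Definition 4 at every level.** [this work] -/
theorem IsCMTP2cis.isCIScylLE :
    ∀ (d : ℕ) (μ : Measure (Fin d → I)) [IsProbabilityMeasure μ], IsCMTP2cis d μ → IsCIScylLE d μ := by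
  intro d
  induction d with
  | zero => intro μ _ _; trivial
  | succ d ih =>
    intro μ _ h
    haveI : IsProbabilityMeasure (μ.map initLast) :=
      Measure.isProbabilityMeasure_map measurable_initLast.aemeasurable
    exact ⟨ih _ h.1, condIncrLastLE_of_isCMTP2Set μ h.2⟩

/-- **cMTP₂-CIS ⟹ CIS in the a.e.-kernel sense, for EVERY probability law on `Q_d`** (no density, no continuity, mixed
atomic/diffuse conditioning marginals allowed) — density-free [FuchsWang2026] Thm. 2.8 (1) + Rem. 2.9. [this work] -/
theorem IsCMTP2cis.isCISae (μ : Measure (Fin d → I)) [IsProbabilityMeasure μ] (h : IsCMTP2cis d μ) :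
    IsCISae d μ :=
  (isCISae_iff_isCIScylLE d μ).2 (IsCMTP2cis.isCIScylLE d μ h)

/-- Hence cMTP₂-CIS laws are monotone Borel images of Lebesgue measure on the cube. [this work] -/
theorem IsCMTP2cis.exists_monotone_coupling (μ : Measure (Fin d → I)) [IsProbabilityMeasure μ]
    (h : IsCMTP2cis d μ) :
    ∃ G : (Fin d → I) → (Fin d → I), Monotone G ∧ Measurable G ∧ (volume : Measure (Fin d → I)).map G = μ :=
  (h.isCISae μ).exists_monotone_coupling

/-- … positively associated (the FKG inequality for all bounded measurable increasing functionals). [this work] -/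
theorem IsCMTP2cis.isPositivelyAssociated (μ : Measure (Fin d → I)) [IsProbabilityMeasure μ]
    (h : IsCMTP2cis d μ) : Literature.Probability.Percolation.IsPositivelyAssociated μ :=
  (h.isCISae μ).isPositivelyAssociated μ

/-- … and Sahi-positive of order `n` given the continuous case `L(d,n)` (unconditionally for `d ≤ 2` or `n ≤ 2`, and
`E₃ ≥ 0` on `[0,1]³`, through `SahiCISPositivity.lean`). [this work] -/
theorem IsCMTP2cis.msahiE_nonneg {n : ℕ} (hL : LiebSahiContinuum d n)
    (μ : Measure (Fin d → I)) [IsProbabilityMeasure μ] (h : IsCMTP2cis d μ) (f : Fin n → (Fin d → I) → ℝ)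
    (hfm : ∀ i, Measurable (f i)) (hf0 : ∀ i x, 0 ≤ f i x) (hmono : ∀ i, Monotone (f i)) :
    0 ≤ Literature.Combinatorics.Sahi2008.msahiE μ n f :=
  (h.isCISae μ).msahiE_nonneg hL μ f hfm hf0 hmono

/-! ### Box-TP₂ ⟹ cMTP₂-CIS -/

/-- `initLast` commutes with `⊓`. [folklore] -/
theorem initLast_inf (x y : Fin (d + 1) → I) : initLast (x ⊓ y) = initLast x ⊓ initLast y := rfl

/-- `initLast` commutes with `⊔`. [folklore] -/
theorem initLast_sup (x y : Fin (d + 1) → I) : initLast (x ⊔ y) = initLast x ⊔ initLast y := rfl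

/-- The law of `((x_0,…,x_{d−1}), x_d)` of a box-TP₂ law satisfies Colangelo–Müller–Scarsini's Definition 2. [this work] -/
theorem mIsSetTP2_map_initLast (μ : Measure (Fin (d + 1) → I)) [IsProbabilityMeasure μ] (hμ : IsBoxTP2 μ) :
    mIsSetTP2 (μ.map initLast) :=
  (hμ.mIsSetTP2 μ).map_of_map_sup_inf measurable_initLast initLast_sup initLast_inf

/-- **Box-TP₂ (density-free MTP₂) ⟹ cMTP₂-CIS** on `Q_d`, every `d`. [this work] -/
theorem _root_.Summit.CriticalPhenomena.PercolationContinuityZ3.Theorems.SahiBoxTP2.IsBoxTP2.isCMTP2cis :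
    ∀ (d : ℕ) (μ : Measure (Fin d → I)) [IsProbabilityMeasure μ], IsBoxTP2 μ → IsCMTP2cis d μ := by
  intro d
  induction d with
  | zero => intro μ _ _; trivial
  | succ d ih =>
    intro μ _ hμ
    haveI : IsProbabilityMeasure (μ.map initLast) :=
      Measure.isProbabilityMeasure_map measurable_initLast.aemeasurable
    exact ⟨ih _ hμ.fst_initLast, isCMTP2Set_of_mIsSetTP2 (mIsSetTP2_map_initLast μ hμ)⟩

end Cube

end Summit.CriticalPhenomena.PercolationContinuityZ3.Theorems.SahiCMTP2
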